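import Summits.QuantumFields.BalabanUV.T4Continuum.Spine.NE3.SupplierB8
import HarnessLib

/-!
# T⁴ programme, node NE3 — REPAIR R24 (γ4), file 3: THE SUPPLIER ON B8's SURFACE WITH UNITARITY OF THE LEVEL-`(j+1)` AVERAGED BACKGROUND ONLY

Cell `pub-balaban-gaps` (YM blitz, track G2, seat `ne3`, unit `pub-balaban-gaps-ne3`; writer prover-pub-balaban-gaps-ne3-g3-0, 2026-08-23), census
`run/shared/lean/pub/pub-balaban-gaps/ne/NE3.md` §4 R24γ4.  `Spine/NE3/SupplierB8.decomposedRepT_slicB8_of_landauRepB8Avg` (p346516 ✓) carries the hypothesis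
`∀ i, IsUnitaryCfg (cavgIter L i (cavg L U_B))` inherited from gen 2's `QbarTowerB8.norm_QbarIter_le`; only the level `i = j+1` is used, and only that level is a theorem of the
multi-level small-field class (`cavgIter_unitary_small`; `cavg` is unitary only under the loop smallness).  THIS FILE re-states the supplier with the dischargeable hypothesis
`IsUnitaryCfg (cavgIter L (j+1) (cavg L U_B))`, inlining the local quadratic letter from `QbarLocalB8.norm_adField_QbarIter_le_local` (which needs no unitarity of averaged
backgrounds) and `norm_Ad_of_unitary` at level `j+1`.  Otherwise VERBATIM.

CONTENT ([folklore]; 0 sorry; no `def`): **`decomposedRepT_slicB8_of_landauRepB8Avg₁`**.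

HONEST FRAMING.  As `SupplierB8`: bookkeeping over landed kernel theorems; the shape `LandauRepB8Avg`, the normal part's letters, the majorant, the regime and the numeric lines are
HYPOTHESES; nothing about Bałaban's minimisers is proved; the chart supplier's sup letters, (P♮), (RES♯)'s projection bound, the covariant root and **NE3 are NOT proved**; spine
PROVED 0∕9; finite T⁴ rung (B)+1 — NOT infinite volume, NOT mass gap, NOT `BetaPertH`, NOT Clay.  PLACEMENT: `Summits/QuantumFields/BalabanUV/T4Continuum/Spine/NE3/`; imports
accepted modules only; moves nothing.  HONEST DEPENDENCY: continuum YM on T⁴ ⇐ BetaPertH ∧ nine spine estimates (0/9 proved); BetaPertH ⇐ (D1) ∧ (D4) ∧ CAP+tail; G-an2-4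
gates asym, D1 and NE2/3/4.
-/

set_option autoImplicit false

open scoped BigOperators Matrix.Norms.L2Operator
open NormedSpace Finset

namespace Summit.QuantumFields.BalabanUV.T4Continuum.NE3.SupplierB8Level

open Set
open Literature.MathematicalPhysics.QuantumFieldTheory.Balaban1983to89
open B7Prop1Explicit B7Prop2Explicit B7Prop3Flat MatrixLog
open T4AveragingDeficitWall (IsSkewDir IsUnitaryCfg SmallField vary curl curlSq dirSq dirL1 fhol Ad)
open T4AveragingDeficitWallBoundary (IsPeriodicCfg periodBox)
open AveragingDeficitPeriodicCounting (IsPeriodicDir)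
open AveragingDeficitChartCalculus (cavg)
open AveragingDeficitMultiLevelPrep (cavgIter LevelSmall)
open BlockAverageVaryDisc (rho0 rho0_pos)
open BlockAveragePushDirGauge (gaugeDir)
open MinimalActionLevels (perWin)
open MinimalActionSandwich (admissible)
open NE3EnergyShapes (IsUnitarySite IsPeriodicSite)
open NE3CovariantCalculus (hsR hsR_sub_left)
open NE3TangentCovariantTower (QbarIter)
open NE3CovariantLineSumsTower (QbarIter_add)
open NE3SmoothRightInverseW (QbarIter_smul)
open NE3LinearisedAverageSup (curvSum)
open NE3EnergyWeightedShapes (energyNormW energyNormW_nonneg)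
open NE3ProductPath (pathΓ prodM prodM_zero skewHalf skewHalf_eq_self)
open NE3ProductPathBounds (energyNormW_le_of_pointwise energyNormW_add_le sum_norm_curl_le_dirL1 curl_add_dir)
open NE3ProductPathChartSlice (DecomposedRepT)
open NE3ProductPathPlaquettes (small_of_residual_data_poly)
open AveragingDeficitDerivCore (dirL1_nonneg)
open NE3EnergyHessCont (perWin_eq_plaqsOf)
open NE3CurlPairedResidualSpread (dirL1_le_of_pointwise)
open NE3ResidualSliceRep (normalPart normalPart_apply norm_normalPart_sub_le norm_normalPart_le normalPart_skew exp_normalPart_mul_exp_neg)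
open NE3DecomposedRepOfLinearNormalPart (sum_norm_curl_normalPart_le)
open NE3LinearNormalPartPreSizes (LocalSupMajorant preSizes_of_letters)
open NE3.PairLandauB8 (avgKernelGauges IsLandauB8 LandauRepB8)
open NE3.PairLandauB8Avg (LandauRepB8Avg slicB8 mem_slicB8_iff skew_of_mem_slicB8 periodic_of_mem_slicB8)
open NE3.QbarLocalB8 (landauRepB8Avg_norm_QbarIter_le_local)
open NE3.DecomposedRepTSlicB8 (decomposedRepT_slicB8_of_linearNormalPart)
open NE3.SupplierB8 (sub_mem_slicB8 pathΓ_normalPart_zero)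
open AveragingDeficitTransport (norm_Ad_of_unitary)

noncomputable section

variable {d : ℕ} {n : Type*} [Fintype n] [DecidableEq n]

/-! ## The supplier with unitarity of the level-`(j+1)` averaged background only -/

/-- **THE CHART SUPPLIER ON B8's SURFACE — with unitarity of the LEVEL-`(j+1)` averaged background only** (the class supplies it: `cavgIter_unitary_small`; the
`∀ i` form of `SupplierB8.decomposedRepT_slicB8_of_landauRepB8Avg` is not dischargeable from the class).  Otherwise VERBATIM that theorem: from `LandauRepB8Avg`, a Landau linear
normal part with its letters, a (Π-REG) majorant, the [B7]-Prop-4 regime and the k-free lines — `DecomposedRepT … (slicB8 …) … ∧ pathΓ X N 0 = Z`. [folklore] -/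
theorem decomposedRepT_slicB8_of_landauRepB8Avg₁ [Nonempty n] {𝒞 : ℕ → _root_.Set (Site d → Fin d → (Matrix n n ℂ)ˣ)} {L N : ℕ} [NeZero N]
    (hL : 2 ≤ L) (hN : 1 ≤ N) (j : ℕ) {V UA UB : Site d → Fin d → (Matrix n n ℂ)ˣ} {x : ℝ}
    -- the class at the background
    (hWu : IsUnitaryCfg (cavg L UB)) (hWk : IsUnitaryCfg (cavgIter L (j + 1) (cavg L UB)))
    (hx : 0 ≤ x) (hsm : LevelSmall d L j x) (hWx : SmallField (cavg L UB) x)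
    (admW : cavg L UB ∈ admissible 𝒞 L (j + 1) V)
    -- the B8 representative with (1.37)
    {u : Site d → (Matrix n n ℂ)ˣ} {Z : Site d → Fin d → Matrix n n ℂ} {s₁ s₂ β : ℝ}
    (h : LandauRepB8Avg L N (j + 1) (cavg L UB) UA u Z s₁ s₂ β) (hs₁ : 0 ≤ s₁) (hα₀ : s₁ * ((L : ℝ)⁻¹) ^ (j + 1) ≤ 1 / 100)
    -- the regime of the local quadratic letter
    {α₀ : ℝ} (hα : 0 < α₀) (hα3 : C0 d * α₀ ≤ 1 / 3) (hα4 : 4 * α₀ ≤ c2' d L)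
    (h52 : pdev (cavg L UB) < α₀ * (((L : ℝ) ^ (j + 1))⁻¹) ^ 2)
    (hsmall : Real.exp (4 * (800 * ((d : ℝ) + 1) ^ 2 * ((d : ℝ) + 4)) * α₀) * (1 + 8 * (131072 * ((d : ℝ) + 1) ^ 2) * s₁) ≤ 2)
    (hc₃ : 2 * s₁ ≤ c3 d L)
    -- the majorant [Π-REG leaf]
    {m : Site d → Fin d → ℝ} {C : ℝ} (hmaj : LocalSupMajorant L N (j + 1) Z m C)
    (hmb : ∀ (z : Site d) (κ : Fin d), m z κ ≤ s₁ * ((L : ℝ)⁻¹) ^ (j + 1))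
    -- the Landau linear normal part and its letters against `φ := QbarIter L (j+1) W Z`
    {Nn : Site d → Fin d → Matrix n n ℂ} {αN aN c₁ c₂ c₃ c₄ : ℝ} (hNs : IsSkewDir Nn) (hNP : IsPeriodicDir Nn ((N * L ^ (j + 1) : ℕ) : ℤ))
    (hNL : IsLandauB8 (d := d) L N (j + 1) (cavg L UB) Nn) (hQ : QbarIter L (j + 1) (cavg L UB) Nn = QbarIter L (j + 1) (cavg L UB) Z)
    (hαN0 : 0 ≤ αN) (hNsup : ∀ (y : Site d) (μ : Fin d), ‖Nn y μ‖ ≤ αN)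
    (hαN : αN ≤ 1 / 2700) (hJ1 : (s₁ * ((L : ℝ)⁻¹) ^ (j + 1) + 43 * αN) * (L : ℝ) ^ (j + 1) ≤ 1)
    (haN : ∀ p ∈ perWin d (N * L ^ (j + 1)), ‖curl (cavg L UB) Nn p‖ ≤ aN) (haN0 : 0 ≤ aN)
    (hc₁ : 0 ≤ c₁) (hc₂ : 0 ≤ c₂) (hc₃' : 0 ≤ c₃) (hc₄ : 0 ≤ c₄)
    (hR1 : dirSq Nn (periodBox (d := d) (N * L ^ (j + 1)))
      ≤ c₁ * (((L : ℝ) ^ (j + 1)) ^ d / ((L : ℝ) ^ (j + 1)) ^ 2) * dirSq (QbarIter L (j + 1) (cavg L UB) Z) (periodBox (d := d) N))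
    (hR2 : curlSq (cavg L UB) Nn (periodBox (d := d) (N * L ^ (j + 1)))
      ≤ c₂ * (((L : ℝ) ^ (j + 1)) ^ d / ((L : ℝ) ^ (j + 1)) ^ 4) * dirSq (QbarIter L (j + 1) (cavg L UB) Z) (periodBox (d := d) N))
    (hR3 : ∑ p ∈ perWin d (N * L ^ (j + 1)), ‖curl (cavg L UB) Nn p‖
      ≤ c₃ * (((L : ℝ) ^ (j + 1)) ^ d / ((L : ℝ) ^ (j + 1)) ^ 2) * dirL1 (QbarIter L (j + 1) (cavg L UB) Z) (periodBox (d := d) N))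
    (hR4 : dirL1 Nn (periodBox (d := d) (N * L ^ (j + 1)))
      ≤ c₄ * (((L : ℝ) ^ (j + 1)) ^ d / (L : ℝ) ^ (j + 1)) * dirL1 (QbarIter L (j + 1) (cavg L UB) Z) (periodBox (d := d) N))
    -- the smallness of the ν-letter
    (hρ : 2 * (c₁ + c₂) * (8 * (131072 * ((d : ℝ) + 1) ^ 2) * Real.exp (4 * (800 * ((d : ℝ) + 1) ^ 2 * ((d : ℝ) + 4)) * α₀)) ^ 2 * C ^ 2
      * s₁ ^ 2 ≤ 1 / 2)
    -- window radii of `W` and of `U_A^u = W·e^{Z}`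
    {xW xA : ℝ} (hxW0 : 0 ≤ xW) (hxA0 : 0 ≤ xA)
    (hxW : ∀ p ∈ perWin d (N * L ^ (j + 1)), ‖((fhol (cavg L UB) p : (Matrix n n ℂ)ˣ) : Matrix n n ℂ) - 1‖ ≤ xW)
    (hxA : ∀ p ∈ perWin d (N * L ^ (j + 1)), ‖((fhol (vary (cavg L UB) Z 1) p : (Matrix n n ℂ)ˣ) : Matrix n n ℂ) - 1‖ ≤ xA) :
    DecomposedRepT 𝒞 L N (j + 1) V UA UB u (fun y μ => Nn y μ - Z y μ) (normalPart Z fun y μ => Nn y μ - Z y μ)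
        (slicB8 (d := d) (n := n) L N (j + 1) (cavg L UB))
        (s₁ * ((L : ℝ)⁻¹) ^ (j + 1) + αN) ((1 + 2048 * (s₁ * ((L : ℝ)⁻¹) ^ (j + 1) + αN)) * αN)
        ((1 + 2048 * Real.sqrt (16 * d + 1))
          * (2 * Real.sqrt (c₁ + c₂) * (8 * (131072 * ((d : ℝ) + 1) ^ 2) * Real.exp (4 * (800 * ((d : ℝ) + 1) ^ 2 * ((d : ℝ) + 4)) * α₀)) * C * s₁))
        (4 * c₃ * (8 * (131072 * ((d : ℝ) + 1) ^ 2) * Real.exp (4 * (800 * ((d : ℝ) + 1) ^ 2 * ((d : ℝ) + 4)) * α₀)) * C ^ 2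
            * ((2 * xW + xA + 2 * aN + 4 * (2048 * (s₁ * ((L : ℝ)⁻¹) ^ (j + 1) + αN) * αN) + 48 * (s₁ * ((L : ℝ)⁻¹) ^ (j + 1)) ^ 2
                + 1300 * ((s₁ * ((L : ℝ)⁻¹) ^ (j + 1) + αN) + (1 + 2048 * (s₁ * ((L : ℝ)⁻¹) ^ (j + 1) + αN)) * αN) ^ 2) * ((L : ℝ) ^ (j + 1)) ^ 2)
          + 8192 * d * (4 * c₄ * (8 * (131072 * ((d : ℝ) + 1) ^ 2) * Real.exp (4 * (800 * ((d : ℝ) + 1) ^ 2 * ((d : ℝ) + 4)) * α₀)) * C ^ 2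
            * ((2 * xW + xA + 2 * aN + 4 * (2048 * (s₁ * ((L : ℝ)⁻¹) ^ (j + 1) + αN) * αN) + 48 * (s₁ * ((L : ℝ)⁻¹) ^ (j + 1)) ^ 2
                + 1300 * ((s₁ * ((L : ℝ)⁻¹) ^ (j + 1) + αN) + (1 + 2048 * (s₁ * ((L : ℝ)⁻¹) ^ (j + 1) + αN)) * αN) ^ 2) * ((L : ℝ) ^ (j + 1)) ^ 2)))
        (1806 * (4 * c₄ * (8 * (131072 * ((d : ℝ) + 1) ^ 2) * Real.exp (4 * (800 * ((d : ℝ) + 1) ^ 2 * ((d : ℝ) + 4)) * α₀)) * C ^ 2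
            * ((2 * xW + xA + 2 * aN + 4 * (2048 * (s₁ * ((L : ℝ)⁻¹) ^ (j + 1) + αN) * αN) + 48 * (s₁ * ((L : ℝ)⁻¹) ^ (j + 1)) ^ 2
                + 1300 * ((s₁ * ((L : ℝ)⁻¹) ^ (j + 1) + αN) + (1 + 2048 * (s₁ * ((L : ℝ)⁻¹) ^ (j + 1) + αN)) * αN) ^ 2) * ((L : ℝ) ^ (j + 1)) ^ 2)))
        (2 * xW + xA + 2 * aN + 4 * (2048 * (s₁ * ((L : ℝ)⁻¹) ^ (j + 1) + αN) * αN) + 48 * (s₁ * ((L : ℝ)⁻¹) ^ (j + 1)) ^ 2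
          + 1300 * ((s₁ * ((L : ℝ)⁻¹) ^ (j + 1) + αN) + (1 + 2048 * (s₁ * ((L : ℝ)⁻¹) ^ (j + 1) + αN)) * αN) ^ 2)
      ∧ pathΓ (fun y μ => Nn y μ - Z y μ) (normalPart Z fun y μ => Nn y μ - Z y μ) 0 = Z := by
  have hL1 : 1 ≤ L := by omega
  have hL0 : (0 : ℝ) < L := by exact_mod_cast (show 0 < L by omega)
  -- abbreviations as plain reals
  set α₀' : ℝ := s₁ * ((L : ℝ)⁻¹) ^ (j + 1) with hα₀'def
  set C₂ : ℝ := 8 * (131072 * ((d : ℝ) + 1) ^ 2) * Real.exp (4 * (800 * ((d : ℝ) + 1) ^ 2 * ((d : ℝ) + 4)) * α₀) with hC₂def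
  set a : ℝ := 2 * xW + xA + 2 * aN + 4 * (2048 * (α₀' + αN) * αN) + 48 * α₀' ^ 2
    + 1300 * ((α₀' + αN) + (1 + 2048 * (α₀' + αN)) * αN) ^ 2 with hadef
  have hξ : α₀' * (L : ℝ) ^ (j + 1) = s₁ := by
    rw [hα₀'def, inv_pow, mul_assoc, inv_mul_cancel₀ (pow_ne_zero _ hL0.ne'), mul_one]
  have hC₂0 : 0 ≤ C₂ := by rw [hC₂def]; positivity
  have hα₀0 : 0 ≤ α₀' := by rw [hα₀'def]; exact mul_nonneg hs₁ (pow_nonneg (inv_nonneg.mpr hL0.le) _)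
  have ha0 : 0 ≤ a := by rw [hadef]; positivity
  -- structural data of the tangent datum `X := Nn − Z`
  have htan : (fun y μ => Nn y μ - Z y μ) ∈ slicB8 (d := d) (n := n) L N (j + 1) (cavg L UB) :=
    sub_mem_slicB8 hL1 j hWu hx hsm hWx h.skew h.per h.landau hNs hNP hNL hQ
  have hXs : IsSkewDir (fun y μ => Nn y μ - Z y μ) := skew_of_mem_slicB8 htan
  -- (1) the local quadratic letter `hφ` from (1.37), the truncation and the majorant
  have hφ : ∀ z ∈ periodBox (d := d) N, ∀ κ : Fin d,
      ‖QbarIter L (j + 1) (cavg L UB) Z z κ‖ ≤ C₂ * ((L : ℝ) ^ (j + 1) * m z κ) ^ 2 := by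
    intro z _ κ
    -- the local letter with unitarity of the level-(j+1) background only (inlined from `QbarLocalB8`)
    have hb0 : 0 ≤ s₁ * ((L : ℝ)⁻¹) ^ (j + 1) := hα₀0
    have hsmall' : Real.exp (4 * (800 * ((d : ℝ) + 1) ^ 2 * ((d : ℝ) + 4)) * α₀)
        * (1 + 8 * (131072 * ((d : ℝ) + 1) ^ 2) * ((L : ℝ) ^ (j + 1) * (s₁ * ((L : ℝ)⁻¹) ^ (j + 1)))) ≤ 2 := by
      rw [show (L : ℝ) ^ (j + 1) * (s₁ * ((L : ℝ)⁻¹) ^ (j + 1)) = s₁ by rw [mul_comm]; exact hξ]; exact hsmall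
    have hc₃'' : 2 * ((L : ℝ) ^ (j + 1) * (s₁ * ((L : ℝ)⁻¹) ^ (j + 1))) ≤ c3 d L := by
      rw [show (L : ℝ) ^ (j + 1) * (s₁ * ((L : ℝ)⁻¹) ^ (j + 1)) = s₁ by rw [mul_comm]; exact hξ]; exact hc₃
    have hdbar : B7Eq92Concrete.dbavgCovIter L (cavg L UB) (expCfg (NE3.QbarDictionary.adField (cavg L UB) Z)) (j + 1) = 1 := by
      rw [← NE3.QbarDictionary.relPert_eq_expCfg_adField]; exact h.dbar
    have hloc := NE3.QbarLocalB8.norm_adField_QbarIter_le_local L hL (cavg L UB) hWu Z j hα hα3 hα4 h52 hb0 h.sup hsmall' hc₃'' hdbar z κ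
      (hmaj.nonneg z κ) (hmb z κ) (hmaj.dom z κ)
    unfold NE3.QbarDictionary.adField at hloc
    rw [norm_Ad_of_unitary (hWk z κ)] at hloc
    rw [hC₂def]; exact hloc
  -- (2) the pre-sizes of `Nn` from the letters
  have hsL : (α₀' + αN) * (L : ℝ) ^ (j + 1) ≤ 1 := by
    have h1 : α₀' + αN ≤ α₀' + 43 * αN := by linarith
    exact (mul_le_mul_of_nonneg_right h1 (by positivity)).trans hJ1
  have hρ' : 2 * (c₁ + c₂) * C₂ ^ 2 * C ^ 2 * (α₀' * (L : ℝ) ^ (j + 1)) ^ 2 ≤ 1 / 2 := by rw [hξ, hC₂def]; exact hρ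
  obtain ⟨hN1, hN2, hN3⟩ := preSizes_of_letters (N := N) hL1 (j + 1) (cavg L UB) (X₀ := Z) (Nn := Nn)
    (φ := QbarIter L (j + 1) (cavg L UB) Z) (m := m) (C₂ := C₂) (C := C) (a := a)
    hα₀0 hαN0 hC₂0 hmaj.hC hc₁ hc₂ hc₃' hc₄ ha0 hmaj.nonneg hmb hmaj.sq hφ hR1 hR2 hR3 hR4 hρ' hsL
  rw [hξ] at hN1
  -- (3) the moving plaquette radius from 3b
  have hs32 : α₀' + αN < 1 / 32 := by linarith
  have hXsup : ∀ y μ, ‖Nn y μ - Z y μ‖ ≤ α₀' + αN := fun y μ =>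
    (norm_sub_le _ _).trans (by rw [add_comm]; exact add_le_add (h.sup y μ) (hNsup y μ))
  have hX32 : ∀ y μ, ‖Nn y μ - Z y μ‖ ≤ 1 / 32 := fun y μ => (hXsup y μ).trans hs32.le
  have hZ32 : ∀ y μ, ‖Z y μ‖ ≤ 1 / 32 := fun y μ => (h.sup y μ).trans (by linarith)
  have hNgs : IsSkewDir (normalPart Z fun y μ => Nn y μ - Z y μ) := normalPart_skew h.skew hXs hZ32 hX32
  have hαN32 : αN < 1 / 32 := by linarith
  have hNgsub : ∀ y μ, ‖normalPart Z (fun y μ => Nn y μ - Z y μ) y μ - Nn y μ‖ ≤ 2048 * (α₀' + αN) * αN := by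
    intro y μ
    have hb := norm_normalPart_sub_le (X₀ := Z) (Nn := Nn) (y := y) (μ := μ) ((hXsup y μ).trans_lt hs32)
      ((hNsup y μ).trans_lt hαN32)
    have h1 : 0 ≤ ‖Nn y μ‖ := norm_nonneg _
    have hs0 : 0 ≤ α₀' + αN := by positivity
    have h2 : ‖Nn y μ - Z y μ‖ * ‖Nn y μ‖ ≤ (α₀' + αN) * αN := mul_le_mul (hXsup y μ) (hNsup y μ) h1 hs0
    have h3 : 2048 * ‖Nn y μ - Z y μ‖ * ‖Nn y μ‖ ≤ 2048 * (α₀' + αN) * αN := by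
      have := mul_le_mul_of_nonneg_left h2 (by norm_num : (0:ℝ) ≤ 2048)
      linarith [this]
    exact hb.trans h3
  have hNgsup : ∀ y μ, ‖normalPart Z (fun y μ => Nn y μ - Z y μ) y μ‖ ≤ (1 + 2048 * (α₀' + αN)) * αN := by
    intro y μ
    calc ‖normalPart Z (fun y μ => Nn y μ - Z y μ) y μ‖
        = ‖(normalPart Z (fun y μ => Nn y μ - Z y μ) y μ - Nn y μ) + Nn y μ‖ := by rw [sub_add_cancel]
      _ ≤ ‖normalPart Z (fun y μ => Nn y μ - Z y μ) y μ - Nn y μ‖ + ‖Nn y μ‖ := norm_add_le _ _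
      _ ≤ 2048 * (α₀' + αN) * αN + αN := add_le_add (hNgsub y μ) (hNsup y μ)
      _ = (1 + 2048 * (α₀' + αN)) * αN := by ring
  have h42 : 1 + 2048 * (α₀' + αN) ≤ 42 := by linarith
  have hαN' : (1 + 2048 * (α₀' + αN)) * αN ≤ 1 / 64 := by
    have hb : (1 + 2048 * (α₀' + αN)) * αN ≤ 42 * αN := mul_le_mul_of_nonneg_right h42 hαN0
    linarith
  have hsmallR : ∀ t ∈ Icc (0:ℝ) 1, ∀ p ∈ perWin d (N * L ^ (j + 1)),
      ‖((fhol (vary (cavg L UB) (pathΓ (fun y μ => Nn y μ - Z y μ) (normalPart Z fun y μ => Nn y μ - Z y μ) t) 1) p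
        : (Matrix n n ℂ)ˣ) : Matrix n n ℂ) - 1‖ ≤ a := by
    intro t ht p hp
    have h3b := small_of_residual_data_poly hWu h.skew hXs hNgs (X₀ := Z) (Nn := Nn) (fun _ _ => rfl) hNgsub h.sup
      (by linarith) hXsup hNgsup hs32.le hαN' (perWin d (N * L ^ (j + 1))) hxW hxA haN ht p hp
    rw [hadef]; exact h3b
  -- (4) file 2 (T-free) and the start of the path
  refine ⟨?_, pathΓ_normalPart_zero h.skew hZ32 hX32⟩
  exact decomposedRepT_slicB8_of_linearNormalPart hL1 hN j hWu admW ⟨h.unitary, h.periodic⟩ h.rep h.skew h.per hα₀0 h.sup htan hα₀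
    hNP hαN0 hNsup hαN hJ1 ha0 hN1 hN2 hN3 hsmallR


end

end Summit.QuantumFields.BalabanUV.T4Continuum.NE3.SupplierB8Level
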